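import Summits.ResolutionOfSingularities.ResolutionOfSingularities.Theorems.FrobeniusClosingPatchingRelPerfectDepthTaylorInitial
import Summits.ResolutionOfSingularities.ResolutionOfSingularities.Theorems.FrobeniusClosingPatchingRelPerfectDepthTaylorPresentation
import HarnessLib

/-!
# Crux `PatchingRelPerfect` (stmt-ResolutionOfSingularities-16161), chain W5.2 — F6 §1: EVERY depth-two member has an initial
# state with a coefficient flag of forms (presentation ∘ package)

[OURS · L1 W5.2 · rung tool] Composition of res-D-pv-055's `exists_taylor_presentation` (`…DepthTaylorPresentation`) and
`taylorPackageTwo` (`…DepthTaylorInitial`): for `S` regular local of dimension `m + 1` with a coefficient field `σ`, generators `x`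
of `𝔪`, and ANY ideal `I ≤ 𝔪ᵈ` containing all `x_k^{d+2}` (the depth-two members at exponent `d`, `HasExceptionalDepth 2 x I`),
there are forms `P₀ˡ` (degree `d`), `P₁ˡ` (degree `d + 1`) over `κ₀` and a state `(X, g, i : ℙᵐ_{κ₀} ⟶ X, K, r)` of the depth-two
invariant for `I` itself with `i ≫ r = 𝟙` and flag `(coeffFlag i r 0 K, coeffFlag i r 1 K) = (𝓟(P₀), 𝓟(P₀) ⊔ 𝓟(P₁))`.

* `DepthTargets.depthTwoMember_initial`.

Fact-free. Rung tool of OUR route; nothing here is a statement of the manuscript under review; AI-written, weaker than expert review.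

## References
* I. S. Cohen, *On the structure and ideal theory of complete local rings*, TAMS 59 (1946), Thm. 9. [Cohen1946]
* H. Kawanoue, K. Matsuki, *Resolution of singularities of an idealistic filtration in dimension 3 after Benito–Villamayor* (2016), §2.
  [KawanoueMatsuki2016]
-/

-- `Summit.<Summit>.<Sub>.Theorems` with `Sub = Summit` (single-conjunct summit, D-0017)
set_option linter.dupNamespace false

noncomputable section

open CategoryTheory CategoryTheory.Limits AlgebraicGeometry Literature.AlgebraicGeometry.Resolution
open Literature.AlgebraicGeometry.Motives

namespace Summit.ResolutionOfSingularities.ResolutionOfSingularities.Theorems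

universe u

namespace DepthTargets

/-- **Every depth-two member has an initial state with a coefficient flag of forms.** `S` regular local of dimension `m + 1`,
`σ` a coefficient field, `x` generators of `𝔪`, `I ≤ 𝔪ᵈ` with `x_k^{d+2} ∈ I` for all `k`: there are finitely many forms
`P₀ˡ ∈ κ₀[T]_d`, `P₁ˡ ∈ κ₀[T]_{d+1}` and a state `(X, g, i, K)` of the depth-two invariant for `I`, with a retraction `r`
(`i ≫ r = 𝟙`), whose coefficient flag is `(𝓟(P₀), 𝓟(P₀) ⊔ 𝓟(P₁))` (`exists_taylor_presentation` ∘ `taylorPackageTwo`).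
[cite: Cohen1946, Thm. 9] [cite: KawanoueMatsuki2016, §2] -/
theorem depthTwoMember_initial {S : Type u} [CommRing S] [IsRegularLocalRing S] {m : ℕ}
    (hdim : ringKrullDim S = (m + 1 : ℕ)) {κ₀ : Type u} [Field κ₀] (σ : κ₀ →+* S)
    (hσ : Function.Bijective ⇑((IsLocalRing.residue S).comp σ)) (x : Fin (m + 1) → S)
    (hx : Ideal.span (Set.range x) = IsLocalRing.maximalIdeal S) {d : ℕ} (I : Ideal S)
    (hI : I ≤ IsLocalRing.maximalIdeal S ^ d) (hxI : ∀ k, x k ^ (d + 2) ∈ I) :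
    ∃ (s : ℕ) (P₀ P₁ : Fin s → MvPolynomial (Fin (m + 1)) κ₀)
      (hP₀ : ∀ l, P₀ l ∈ MvPolynomial.homogeneousSubmodule (Fin (m + 1)) κ₀ d)
      (hP₁ : ∀ l, P₁ l ∈ MvPolynomial.homogeneousSubmodule (Fin (m + 1)) κ₀ (d + 1))
      (X : Scheme.{u}) (g : X ⟶ Spec (.of S)) (i : ProjSpace.P m κ₀ ⟶ X) (K : X.IdealSheafData)
      (r : X ⟶ ProjSpace.P m κ₀),
      DepthInvariant 2 S I (ProjSpace.P m κ₀) X i g K ∧ i ≫ r = 𝟙 _ ∧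
        DepthGraded.coeffFlag i r 0 K = formsIdealSheaf κ₀ m d P₀ hP₀ ∧
        DepthGraded.coeffFlag i r 1 K = formsIdealSheaf κ₀ m d P₀ hP₀ ⊔ formsIdealSheaf κ₀ m (d + 1) P₁ hP₁ := by
  obtain ⟨s, P₀, P₁, G, hP₀, hP₁, hG, hIeq⟩ := exists_taylor_presentation σ hσ x hx I hI hxI
  obtain ⟨X, g, i, K, r, hinv, hir, h0, h1⟩ := taylorPackageTwo S m hdim κ₀ σ hσ x hx d s P₀ hP₀ P₁ hP₁ G hG
  refine ⟨s, P₀, P₁, hP₀, hP₁, X, g, i, K, r, ?_, hir, h0, h1⟩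
  rw [hIeq]
  exact hinv

end DepthTargets

end Summit.ResolutionOfSingularities.ResolutionOfSingularities.Theorems

end
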